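import Mathlib
import HarnessLib

/-!
# FunctionalMining — the exact `2 × 2` reduction for the eigenvalues of `tK + E` near the double top of `K` (F1 PART I, Lemma 10 (b))

Search for candidate a priori estimates; no regularity claim. Cell `pub-nsfunc`, prove seat
(gen 21). Kernel form of the algebraic step (b) of the no-go seat's F1 PART I LEMMA 10 (four-party
pen nogo × dict × census-1 × census-2 — not a cited fact). In the frame `ℝ³ = n^⊥ ⊕ ℝn` with
`K = m(𝟙 − 3n⊗n)` and `E = [[B, b], [bᵀ, e_nn]]`,

  `S = tK + E = [[tm + B₀₀, B₀₁, b₀], [B₀₁, tm + B₁₁, b₁], [b₀, b₁, −2tm + e_nn]]`,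

and for `D(λ) := λ + 2tm − e_nn ≠ 0`:

* **`BlockReduction.reduction`** — if `S (w, s) = λ (w, s)` then `s·D(λ) = ⟨b, w⟩` (the `n`-row) and
  `M(λ) w = (λ − tm) w` with `M(λ) = B + b⊗b/D(λ)` (the `2 × 2` reduced eigen-problem, written
  multiplied through by `D(λ)`);
* **`BlockReduction.reduction_converse`** — conversely an eigenpair of `M(λ)` with eigenvalue `λ − tm`
  lifts to the eigenvector `(w, ⟨b, w⟩/D(λ))` of `S`;
* `BlockReduction.axis_eigenvector` — a vector `(0, 0, s)`, `s ≠ 0`, is an eigenvector only if `b = 0`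
  and `λ = −2tm + e_nn` (the eigenplane of a double top projects injectively to `n^⊥`).

The analytic parts (a), (c)–(e) of Lemma 10 (Weyl, the `R*` remainder, Davis–Kahan) are not in this
file. Elementary algebra over `ℝ`. [ours; folklore]
-/

noncomputable section

open Matrix

namespace Summit.NavierStokesRegularity.FunctionalMining

namespace BlockReduction

/-- **Lemma 10 (b), forward: the `n`-row and the reduced `2 × 2` problem.** If
`S (w₀, w₁, s) = λ (w₀, w₁, s)` for `S = [[tm + B₀₀, B₀₁, b₀], [B₀₁, tm + B₁₁, b₁], [b₀, b₁, −2tm + e_nn]]`,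
then with `D = λ + 2tm − e_nn`: `s D = b₀w₀ + b₁w₁`, and (multiplying the reduced equations by `D`)
`D (B w)ᵢ + bᵢ (b₀w₀ + b₁w₁) = D (λ − tm) wᵢ`, `i = 0, 1` — i.e. `(B + b⊗b/D) w = (λ − tm) w` when
`D ≠ 0`. [folklore; F1 PART I Lemma 10 (b)] -/
theorem reduction {t m B00 B01 B11 b0 b1 enn lam w0 w1 s : ℝ}
    (h : !![t * m + B00, B01, b0; B01, t * m + B11, b1; b0, b1, -2 * (t * m) + enn] *ᵥ ![w0, w1, s] =
      lam • ![w0, w1, s]) :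
    s * (lam + 2 * (t * m) - enn) = b0 * w0 + b1 * w1 ∧
      (lam + 2 * (t * m) - enn) * (B00 * w0 + B01 * w1) + b0 * (b0 * w0 + b1 * w1) =
        (lam + 2 * (t * m) - enn) * ((lam - t * m) * w0) ∧
      (lam + 2 * (t * m) - enn) * (B01 * w0 + B11 * w1) + b1 * (b0 * w0 + b1 * w1) =
        (lam + 2 * (t * m) - enn) * ((lam - t * m) * w1) := by
  have r0 := congrFun h 0
  have r1 := congrFun h 1
  have r2 := congrFun h 2
  simp [Matrix.mulVec, dotProduct, Fin.sum_univ_three] at r0 r1 r2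
  refine ⟨by linear_combination -r2, ?_, ?_⟩
  · linear_combination (lam + 2 * (t * m) - enn) * r0 + b0 * r2
  · linear_combination (lam + 2 * (t * m) - enn) * r1 + b1 * r2

/-- The reduced problem in divided form: if moreover `D = λ + 2tm − e_nn ≠ 0` then `s = ⟨b, w⟩/D` and
`B w + (⟨b, w⟩/D) b = (λ − tm) w`. [folklore; F1 PART I Lemma 10 (b)] -/
theorem reduction_div {t m B00 B01 B11 b0 b1 enn lam w0 w1 s : ℝ}
    (h : !![t * m + B00, B01, b0; B01, t * m + B11, b1; b0, b1, -2 * (t * m) + enn] *ᵥ ![w0, w1, s] =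
      lam • ![w0, w1, s]) (hD : lam + 2 * (t * m) - enn ≠ 0) :
    s = (b0 * w0 + b1 * w1) / (lam + 2 * (t * m) - enn) ∧
      B00 * w0 + B01 * w1 + (b0 * w0 + b1 * w1) / (lam + 2 * (t * m) - enn) * b0 = (lam - t * m) * w0 ∧
      B01 * w0 + B11 * w1 + (b0 * w0 + b1 * w1) / (lam + 2 * (t * m) - enn) * b1 = (lam - t * m) * w1 := by
  obtain ⟨h1, -, -⟩ := reduction h
  have r0 := congrFun h 0
  have r1 := congrFun h 1
  simp [Matrix.mulVec, dotProduct, Fin.sum_univ_three] at r0 r1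
  have hs : s = (b0 * w0 + b1 * w1) / (lam + 2 * (t * m) - enn) := by
    rw [eq_div_iff hD]; linear_combination h1
  refine ⟨hs, ?_, ?_⟩
  · rw [← hs]; linear_combination r0
  · rw [← hs]; linear_combination r1

/-- **Lemma 10 (b), converse**: an eigenpair `(λ − tm, w)` of `M(λ) = B + b⊗b/D(λ)`, `D(λ) ≠ 0`, lifts to
the eigenvector `(w, ⟨b, w⟩/D(λ))` of `S` with eigenvalue `λ`. [folklore; F1 PART I Lemma 10 (b)] -/
theorem reduction_converse {t m B00 B01 B11 b0 b1 enn lam w0 w1 : ℝ}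
    (hD : lam + 2 * (t * m) - enn ≠ 0)
    (h0 : B00 * w0 + B01 * w1 + (b0 * w0 + b1 * w1) / (lam + 2 * (t * m) - enn) * b0 = (lam - t * m) * w0)
    (h1 : B01 * w0 + B11 * w1 + (b0 * w0 + b1 * w1) / (lam + 2 * (t * m) - enn) * b1 = (lam - t * m) * w1) :
    !![t * m + B00, B01, b0; B01, t * m + B11, b1; b0, b1, -2 * (t * m) + enn] *ᵥ
        ![w0, w1, (b0 * w0 + b1 * w1) / (lam + 2 * (t * m) - enn)] =
      lam • ![w0, w1, (b0 * w0 + b1 * w1) / (lam + 2 * (t * m) - enn)] := by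
  ext i
  fin_cases i
  · simp [Matrix.mulVec, dotProduct, Fin.sum_univ_three]
    linear_combination h0
  · simp [Matrix.mulVec, dotProduct, Fin.sum_univ_three]
    linear_combination h1
  · simp [Matrix.mulVec, dotProduct, Fin.sum_univ_three]
    have e : (lam + 2 * (t * m) - enn)⁻¹ * (lam + 2 * (t * m) - enn) = 1 := inv_mul_cancel₀ hD
    rw [div_eq_mul_inv]
    linear_combination (-(b0 * w0 + b1 * w1)) * e

/-- **The eigenplane of a double top projects injectively to `n^⊥`**: `(0, 0, s)` with `s ≠ 0` is an
eigenvector of `S` only if `b = 0` and `λ = −2tm + e_nn`. [folklore; F1 PART I Lemma 10, proof of (c)] -/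
theorem axis_eigenvector {t m B00 B01 B11 b0 b1 enn lam s : ℝ} (hs : s ≠ 0)
    (h : !![t * m + B00, B01, b0; B01, t * m + B11, b1; b0, b1, -2 * (t * m) + enn] *ᵥ ![0, 0, s] =
      lam • ![0, 0, s]) :
    b0 = 0 ∧ b1 = 0 ∧ lam = -2 * (t * m) + enn := by
  have r0 := congrFun h 0
  have r1 := congrFun h 1
  have r2 := congrFun h 2
  simp [Matrix.mulVec, dotProduct, Fin.sum_univ_three] at r0 r1 r2
  refine ⟨?_, ?_, ?_⟩
  · rcases r0 with h0 | h0
    · exact h0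
    · exact absurd h0 hs
  · rcases r1 with h0 | h0
    · exact h0
    · exact absurd h0 hs
  · rcases r2 with h0 | h0
    · linarith
    · exact absurd h0 hs

end BlockReduction

end Summit.NavierStokesRegularity.FunctionalMining

end
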